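import Summits.QuantumFields.BalabanUV.Beta.FP.NestedSliceDeadJets
import Summits.QuantumFields.BalabanUV.Beta.FP.TorusOneShotFPExponential
import Summits.QuantumFields.BalabanUV.Beta.FP.NestedStepLawTorusInstance

/-!
# `BalabanUV.Beta.FP.NestedFPSplit` — road «FP» for binder row D1, ROUTE T: **THE NESTED FADDEEV–POPOV 2-JET SPLITS OVER THE TWO CHARTS** —
# under leaf-02's covariance letters `c0 c1 c2` ALONE the nested FP matrix and its two jets are BLOCK LOWER-TRIANGULAR, so
# `secondVar (nested FP) = secondVar (τ₂·D̄, τ₂·D̄₁, τ₂·D̄₂) + secondVar (τ₁·W₀ˡᵒʷ, τ₁·W₁ˡᵒʷ, τ₁·W₂ˡᵒʷ)` — the door's `uT` input from ONE coarse-comb letter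
# and ONE fine-comb letter, each of which can be AUTOMATIC (exponential jets on a comb: `TorusOneShotFPExponential ∕ TorusCompositeFP`) instead of the four
# dead-row letters `s1 s2 t1 t2` (my g17∕g18 `NestedSliceDeadJets.hUT_of_dead_letters ∕ NestedStepLawTransported.secondVar_nestedFP_eq_zero` are the case «all four
# blocks' jets vanish»)

WHAT ([folklore] trace bookkeeping, generic index types).  §1 `secondVar_fromBlocks_zero₁₂`: for block lower-triangular 2-jets (upper-right block `0` in all three
matrices) `secondVar (fromBlocks A₀ 0 C₀ D₀) (fromBlocks A₁ 0 C₁ D₁) (fromBlocks A₂ 0 C₂ D₂) = secondVar A₀ A₁ A₂ + secondVar D₀ D₁ D₂` (`A₀ D₀` invertible; the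
off-diagonal jets `Cₖ` drop out — `log|det| = log|det A| + log|det D|` along the curve; here by `Matrix.inv_fromBlocks_zero₁₂_of_isUnit_iff` and traces of block
products).  §2 the nested FP matrix of the OWNER's door (`NestedStepLawTransported(ExpGraded)._of_uni`'s `uT` socket, jets displayed as in
`NestedSliceDeadJets.hUT_of_dead_letters`): with `c0 : Q₁₀ W₀ = [D̄ | 0]`, `c1 : Q₁₁ W₀ + Q₁₀ W₁ = [D̄₁ | 0]`, `c2 : Q₁₂ W₀ + 2•Q₁₁ W₁ + Q₁₀ W₂ = [D̄₂ | 0]`,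
`[τ₂ Q₁₀; τ₁]·W₀ = fromBlocks (τ₂ D̄) 0 (τ₁ W₀ᵗᵒᵖ) (τ₁ W₀ˡᵒʷ)` and the two jets likewise (`nestedFP₀_eq ∕ nestedFP₁_eq ∕ nestedFP₂_eq`; `Wᵗᵒᵖ ∕ Wˡᵒʷ := toCols₁ ∕ toCols₂`),
hence **`secondVar_nestedFP_eq_add`** and the two sockets **`secondVar_nestedFP_eq_zero_of_blocks`** (`uT ⟸ secondVar (τ₂ D̄, τ₂ D̄₁, τ₂ D̄₂) = 0 ∧
secondVar (τ₁ W₀ˡᵒʷ, τ₁ W₁ˡᵒʷ, τ₁ W₂ˡᵒʷ) = 0`) and **`secondVar_nestedFP_eq_zero_of_dead_top`** (the coarse letters in dead form `τ₂ D̄₁ = τ₂ D̄₂ = 0` — the depth-1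
`hdead` ∕ `t1 t2` content — plus the fine block's `secondVar = 0`, which at the (B) torus call is `TorusOneShotFPExponential.secondVar_combRowsT_expJets_eq_zero` on
the SMALL comb with NO hypothesis on the direction, and at the composite call with the one-shot fine slice is leaf-06 g20's `TorusCompositeFP.torus_uP_exp_tower`
one level down).  So `s1 s2` (`hsmall`) need not be displayed at any depth once the fine block is read this way.  No `def`, no `def … : Prop`, nothing cited,
0 sorry.  Nothing of the dictionary ∕ Bałaban's asserted.

HONEST DEPENDENCY (page 1, mandatory): continuum YM on T⁴ ⇐ BetaPertH ∧ nine spine estimates (0/9 proved); BetaPertH ⇐ (D1) ∧ (D4) ∧ CAP+tail;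
G-an2-4 gates asym, D1 and NE2/3/4.  HONEST FRAMING (cell contract, verbatim): «discharging `BetaPertH` makes Bałaban's UV stability UNCONDITIONAL —
a real constructive-QFT result; it is NOT the continuum limit and NOT the Clay problem.»  ABSOLUTE RULE (cell charter, verbatim): «No internally-minted
statement may enter as a cited fact. Every hypothesis is either kernel-proved in this package or a verbatim quotation of a PUBLISHED theorem with page
reference. The manuscript(s) under audit are NOT citable for their own disputed steps — they are the thing under adjudication; programme-internal
(2001/route/tribunal) claims are never citable.»  0 estimates; 0∕4 row-D1 binders; NOT (T-ID), NOT SDF, NOT D1, NOT BetaPertH, NOT continuum, NOT Clay.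
D1 formalisation swarm LEAF PROVER 06 (b2b-balaban-beta-d1-formalise-leaf-06 gen 21), 2026-08-22.  No existing file touched.
-/

noncomputable section

namespace Summit.QuantumFields.BalabanUV.Beta.FP.NestedFPSplit

open Matrix
open Literature.MathematicalPhysics.QuantumFieldTheory.Balaban1983to89
open Literature.MathematicalPhysics.QuantumFieldTheory.Balaban1983to89.Beta
open Literature.MathematicalPhysics.QuantumFieldTheory.LatticeForm (quo)
open B5Prop11Plancherel (fine)
open B6Lemma24Torus (pbox)
open AffineAveraging (Site box toSite unitVec)
open OneStepResolventKernel (Fib)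
open Summit.QuantumFields.BalabanUV.Beta.D1BFx.LogDetSecondVariation (secondVar)
open Summit.QuantumFields.BalabanUV.Beta.FP.KernelPeriodisationFib (Idx)
open Summit.QuantumFields.BalabanUV.Beta.FP.TorusGaugeCovariance (tgrad tdelta)
open Summit.QuantumFields.BalabanUV.Beta.FP.TorusCombRows (Res combRowsT)
open Summit.QuantumFields.BalabanUV.Beta.FP.CombSliceJetLetters (secondVar_zero_jets)
open Summit.QuantumFields.BalabanUV.Beta.FP.NestedSliceDeadJets (nestedJet₁_eq nestedJet₂_eq)
open Summit.QuantumFields.BalabanUV.Beta.FP.TorusOneShotFPExponential (secondVar_combRowsT_expJets_eq_zero)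
open Summit.QuantumFields.BalabanUV.Beta.FP.NestedStepLawTorusInstance (submatrix_field_mul submatrix_id_mul dvd_fine)
open Summit.QuantumFields.BalabanUV.Beta.GAN24.FineReadoutCauchyFrame (toSite_mem_range)

/-! ## §1 `secondVar` of block lower-triangular 2-jets -/

section Triangular

variable {m n : Type*} [Fintype m] [Fintype n] [DecidableEq m] [DecidableEq n]

omit [DecidableEq m] [DecidableEq n] in
/-- [folklore] the trace of a square block matrix is the sum of its diagonal blocks' traces. -/
theorem trace_fromBlocks_eq (A : Matrix m m ℝ) (B : Matrix m n ℝ) (C : Matrix n m ℝ) (D : Matrix n n ℝ) :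
    (Matrix.fromBlocks A B C D).trace = A.trace + D.trace := by
  simp [Matrix.trace, Fintype.sum_sum_type]

/-- [folklore] **`secondVar` OF BLOCK LOWER-TRIANGULAR 2-JETS IS THE SUM OVER THE DIAGONAL BLOCKS** — the off-diagonal jets drop out
(`log|det fromBlocks A 0 C D| = log|det A| + log|det D|`). -/
theorem secondVar_fromBlocks_zero₁₂ (A₀ A₁ A₂ : Matrix m m ℝ) (C₀ C₁ C₂ : Matrix n m ℝ) (D₀ D₁ D₂ : Matrix n n ℝ) (hA : A₀.det ≠ 0) (hD : D₀.det ≠ 0) :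
    secondVar (Matrix.fromBlocks A₀ 0 C₀ D₀) (Matrix.fromBlocks A₁ 0 C₁ D₁) (Matrix.fromBlocks A₂ 0 C₂ D₂)
      = secondVar A₀ A₁ A₂ + secondVar D₀ D₁ D₂ := by
  have hAD : IsUnit A₀ ↔ IsUnit D₀ := by
    rw [Matrix.isUnit_iff_isUnit_det, Matrix.isUnit_iff_isUnit_det, isUnit_iff_ne_zero, isUnit_iff_ne_zero]
    exact ⟨fun _ => hD, fun _ => hA⟩
  unfold secondVar
  rw [Matrix.inv_fromBlocks_zero₁₂_of_isUnit_iff _ _ _ hAD]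
  simp only [Matrix.fromBlocks_multiply, Matrix.zero_mul, Matrix.mul_zero, add_zero, zero_add, trace_fromBlocks_eq]
  ring

end Triangular

/-! ## §2 The nested Faddeev–Popov matrix and its jets are block lower-triangular under the covariance letters -/

section Nested

variable {ν μ ρ₁ ρ₂ : Type*} [Fintype ν] [Fintype μ]

omit [Fintype μ] in
/-- [folklore] a product against a two-block column matrix, split by its column blocks (definitional). -/
theorem mul_eq_fromCols_toCols (τ : Matrix ρ₁ ν ℝ) (W : Matrix ν (ρ₂ ⊕ ρ₁) ℝ) :
    τ * W = Matrix.fromCols (τ * W.toCols₁) (τ * W.toCols₂) := by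
  ext i (j | j) <;> rfl

omit [Fintype μ] in
/-- [folklore] the left column block of a covariance letter: `Q · Wᵗᵒᵖ = D̄`. -/
theorem mul_toCols₁_of_eq_fromCols (Q : Matrix μ ν ℝ) (W : Matrix ν (ρ₂ ⊕ ρ₁) ℝ) (Db : Matrix μ ρ₂ ℝ)
    (h : Q * W = Matrix.fromCols Db (0 : Matrix μ ρ₁ ℝ)) : Q * W.toCols₁ = Db :=
  Matrix.ext fun i j => congrFun (congrFun h i) (Sum.inl j)

omit [Fintype μ] in
/-- [folklore] the right column block of a covariance letter: `Q · Wˡᵒʷ = 0`. -/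
theorem mul_toCols₂_of_eq_fromCols (Q : Matrix μ ν ℝ) (W : Matrix ν (ρ₂ ⊕ ρ₁) ℝ) (Db : Matrix μ ρ₂ ℝ)
    (h : Q * W = Matrix.fromCols Db (0 : Matrix μ ρ₁ ℝ)) : Q * W.toCols₂ = 0 :=
  Matrix.ext fun i j => congrFun (congrFun h i) (Sum.inr j)

/-- [folklore] **THE NESTED FP MATRIX IS BLOCK LOWER-TRIANGULAR** under `c0 : Q₁₀ W₀ = [D̄ | 0]`:
`[τ₂ Q₁₀; τ₁]·W₀ = fromBlocks (τ₂ D̄) 0 (τ₁ W₀ᵗᵒᵖ) (τ₁ W₀ˡᵒʷ)`. -/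
theorem nestedFP₀_eq (τ₁ : Matrix ρ₁ ν ℝ) (τ₂ : Matrix ρ₂ μ ℝ) (Q₁₀ : Matrix μ ν ℝ) (W₀ : Matrix ν (ρ₂ ⊕ ρ₁) ℝ) (Dbar : Matrix μ ρ₂ ℝ)
    (c0 : Q₁₀ * W₀ = Matrix.fromCols Dbar (0 : Matrix μ ρ₁ ℝ)) :
    Matrix.fromRows (τ₂ * Q₁₀) τ₁ * W₀ = Matrix.fromBlocks (τ₂ * Dbar) 0 (τ₁ * W₀.toCols₁) (τ₁ * W₀.toCols₂) := by
  rw [Matrix.fromRows_mul, Matrix.mul_assoc, c0, Matrix.mul_fromCols, Matrix.mul_zero, mul_eq_fromCols_toCols τ₁ W₀,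
    Matrix.fromRows_fromCols_eq_fromBlocks]

/-- [folklore] **THE FIRST NESTED FP JET IS BLOCK LOWER-TRIANGULAR** under `c1 : Q₁₁ W₀ + Q₁₀ W₁ = [D̄₁ | 0]` (jet displayed as in the door's `uT` socket). -/
theorem nestedFP₁_eq (τ₁ : Matrix ρ₁ ν ℝ) (τ₂ : Matrix ρ₂ μ ℝ) (Q₁₀ Q₁₁ : Matrix μ ν ℝ) (W₀ W₁ : Matrix ν (ρ₂ ⊕ ρ₁) ℝ) (Db₁ : Matrix μ ρ₂ ℝ)
    (c1 : Q₁₁ * W₀ + Q₁₀ * W₁ = Matrix.fromCols Db₁ (0 : Matrix μ ρ₁ ℝ)) :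
    Matrix.fromRows (τ₂ * Q₁₁) (0 : Matrix ρ₁ ν ℝ) * W₀ + Matrix.fromRows (τ₂ * Q₁₀) τ₁ * W₁
      = Matrix.fromBlocks (τ₂ * Db₁) 0 (τ₁ * W₁.toCols₁) (τ₁ * W₁.toCols₂) := by
  rw [nestedJet₁_eq, c1, Matrix.mul_fromCols, Matrix.mul_zero, mul_eq_fromCols_toCols τ₁ W₁, Matrix.fromRows_fromCols_eq_fromBlocks]

/-- [folklore] **THE SECOND NESTED FP JET IS BLOCK LOWER-TRIANGULAR** under `c2 : Q₁₂ W₀ + 2•Q₁₁ W₁ + Q₁₀ W₂ = [D̄₂ | 0]`. -/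
theorem nestedFP₂_eq (τ₁ : Matrix ρ₁ ν ℝ) (τ₂ : Matrix ρ₂ μ ℝ) (Q₁₀ Q₁₁ Q₁₂ : Matrix μ ν ℝ) (W₀ W₁ W₂ : Matrix ν (ρ₂ ⊕ ρ₁) ℝ) (Db₂ : Matrix μ ρ₂ ℝ)
    (c2 : Q₁₂ * W₀ + (2 : ℝ) • (Q₁₁ * W₁) + Q₁₀ * W₂ = Matrix.fromCols Db₂ (0 : Matrix μ ρ₁ ℝ)) :
    Matrix.fromRows (τ₂ * Q₁₂) (0 : Matrix ρ₁ ν ℝ) * W₀ + Matrix.fromRows (τ₂ * Q₁₁) (0 : Matrix ρ₁ ν ℝ) * W₁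
        + (Matrix.fromRows (τ₂ * Q₁₁) (0 : Matrix ρ₁ ν ℝ) * W₁ + Matrix.fromRows (τ₂ * Q₁₀) τ₁ * W₂)
      = Matrix.fromBlocks (τ₂ * Db₂) 0 (τ₁ * W₂.toCols₁) (τ₁ * W₂.toCols₂) := by
  rw [nestedJet₂_eq, c2, Matrix.mul_fromCols, Matrix.mul_zero, mul_eq_fromCols_toCols τ₁ W₂, Matrix.fromRows_fromCols_eq_fromBlocks]

variable [Fintype ρ₁] [Fintype ρ₂] [DecidableEq ρ₁] [DecidableEq ρ₂]

/-- [folklore] **THE NESTED FADDEEV–POPOV 2-JET SPLITS OVER THE TWO CHARTS**: under `c0 c1 c2` (leaf-02's covariance letters, ANY `Q₁ₖ W₀ Wₖ τ₁ τ₂`) and the two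
diagonal zeroth blocks non-degenerate (`det (τ₂ D̄) ≠ 0` — the coarse (UNI) letter; `det (τ₁ W₀ˡᵒʷ) ≠ 0` — the fine one),
`secondVar (nested FP jets) = secondVar (τ₂ D̄, τ₂ D̄₁, τ₂ D̄₂) + secondVar (τ₁ W₀ˡᵒʷ, τ₁ W₁ˡᵒʷ, τ₁ W₂ˡᵒʷ)`. -/
theorem secondVar_nestedFP_eq_add (τ₁ : Matrix ρ₁ ν ℝ) (τ₂ : Matrix ρ₂ μ ℝ) (Q₁₀ Q₁₁ Q₁₂ : Matrix μ ν ℝ) (W₀ W₁ W₂ : Matrix ν (ρ₂ ⊕ ρ₁) ℝ)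
    (Dbar Db₁ Db₂ : Matrix μ ρ₂ ℝ)
    (c0 : Q₁₀ * W₀ = Matrix.fromCols Dbar (0 : Matrix μ ρ₁ ℝ)) (c1 : Q₁₁ * W₀ + Q₁₀ * W₁ = Matrix.fromCols Db₁ (0 : Matrix μ ρ₁ ℝ))
    (c2 : Q₁₂ * W₀ + (2 : ℝ) • (Q₁₁ * W₁) + Q₁₀ * W₂ = Matrix.fromCols Db₂ (0 : Matrix μ ρ₁ ℝ))
    (hup : (τ₂ * Dbar).det ≠ 0) (hlow : (τ₁ * W₀.toCols₂).det ≠ 0) :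
    secondVar (Matrix.fromRows (τ₂ * Q₁₀) τ₁ * W₀) (Matrix.fromRows (τ₂ * Q₁₁) (0 : Matrix ρ₁ ν ℝ) * W₀ + Matrix.fromRows (τ₂ * Q₁₀) τ₁ * W₁)
        (Matrix.fromRows (τ₂ * Q₁₂) (0 : Matrix ρ₁ ν ℝ) * W₀ + Matrix.fromRows (τ₂ * Q₁₁) (0 : Matrix ρ₁ ν ℝ) * W₁
          + (Matrix.fromRows (τ₂ * Q₁₁) (0 : Matrix ρ₁ ν ℝ) * W₁ + Matrix.fromRows (τ₂ * Q₁₀) τ₁ * W₂))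
      = secondVar (τ₂ * Dbar) (τ₂ * Db₁) (τ₂ * Db₂) + secondVar (τ₁ * W₀.toCols₂) (τ₁ * W₁.toCols₂) (τ₁ * W₂.toCols₂) := by
  rw [nestedFP₀_eq τ₁ τ₂ Q₁₀ W₀ Dbar c0, nestedFP₁_eq τ₁ τ₂ Q₁₀ Q₁₁ W₀ W₁ Db₁ c1, nestedFP₂_eq τ₁ τ₂ Q₁₀ Q₁₁ Q₁₂ W₀ W₁ W₂ Db₂ c2]
  exact secondVar_fromBlocks_zero₁₂ _ _ _ _ _ _ _ _ _ hup hlow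

/-- [folklore] **THE DOOR's `uT` SOCKET FROM TWO BLOCK LETTERS**: the nested FP 2-jet vanishes if the coarse-comb block's and the fine-comb block's 2-jets both do
(each AUTOMATIC for exponential jets read on a comb: `TorusOneShotFPExponential.secondVar_combRowsT_expJets_eq_zero`, `TorusCompositeFP.torus_uP_exp_tower`). -/
theorem secondVar_nestedFP_eq_zero_of_blocks (τ₁ : Matrix ρ₁ ν ℝ) (τ₂ : Matrix ρ₂ μ ℝ) (Q₁₀ Q₁₁ Q₁₂ : Matrix μ ν ℝ) (W₀ W₁ W₂ : Matrix ν (ρ₂ ⊕ ρ₁) ℝ)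
    (Dbar Db₁ Db₂ : Matrix μ ρ₂ ℝ)
    (c0 : Q₁₀ * W₀ = Matrix.fromCols Dbar (0 : Matrix μ ρ₁ ℝ)) (c1 : Q₁₁ * W₀ + Q₁₀ * W₁ = Matrix.fromCols Db₁ (0 : Matrix μ ρ₁ ℝ))
    (c2 : Q₁₂ * W₀ + (2 : ℝ) • (Q₁₁ * W₁) + Q₁₀ * W₂ = Matrix.fromCols Db₂ (0 : Matrix μ ρ₁ ℝ))
    (hup : (τ₂ * Dbar).det ≠ 0) (hlow : (τ₁ * W₀.toCols₂).det ≠ 0)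
    (uTop : secondVar (τ₂ * Dbar) (τ₂ * Db₁) (τ₂ * Db₂) = 0) (uLow : secondVar (τ₁ * W₀.toCols₂) (τ₁ * W₁.toCols₂) (τ₁ * W₂.toCols₂) = 0) :
    secondVar (Matrix.fromRows (τ₂ * Q₁₀) τ₁ * W₀) (Matrix.fromRows (τ₂ * Q₁₁) (0 : Matrix ρ₁ ν ℝ) * W₀ + Matrix.fromRows (τ₂ * Q₁₀) τ₁ * W₁)
        (Matrix.fromRows (τ₂ * Q₁₂) (0 : Matrix ρ₁ ν ℝ) * W₀ + Matrix.fromRows (τ₂ * Q₁₁) (0 : Matrix ρ₁ ν ℝ) * W₁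
          + (Matrix.fromRows (τ₂ * Q₁₁) (0 : Matrix ρ₁ ν ℝ) * W₁ + Matrix.fromRows (τ₂ * Q₁₀) τ₁ * W₂)) = 0 := by
  rw [secondVar_nestedFP_eq_add τ₁ τ₂ Q₁₀ Q₁₁ Q₁₂ W₀ W₁ W₂ Dbar Db₁ Db₂ c0 c1 c2 hup hlow, uTop, uLow, add_zero]

/-- [folklore] **THE DOOR's `uT` SOCKET FROM THE COARSE DEAD LETTERS AND THE FINE BLOCK** (the depth-1 `hdead` ∕ `t1 t2` content, NO `s1 s2`): if the coarse
jets are dead on the coarse comb (`τ₂ D̄₁ = τ₂ D̄₂ = 0`) and the fine block's FP 2-jet vanishes, the nested FP 2-jet vanishes. -/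
theorem secondVar_nestedFP_eq_zero_of_dead_top (τ₁ : Matrix ρ₁ ν ℝ) (τ₂ : Matrix ρ₂ μ ℝ) (Q₁₀ Q₁₁ Q₁₂ : Matrix μ ν ℝ) (W₀ W₁ W₂ : Matrix ν (ρ₂ ⊕ ρ₁) ℝ)
    (Dbar Db₁ Db₂ : Matrix μ ρ₂ ℝ)
    (c0 : Q₁₀ * W₀ = Matrix.fromCols Dbar (0 : Matrix μ ρ₁ ℝ)) (c1 : Q₁₁ * W₀ + Q₁₀ * W₁ = Matrix.fromCols Db₁ (0 : Matrix μ ρ₁ ℝ))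
    (c2 : Q₁₂ * W₀ + (2 : ℝ) • (Q₁₁ * W₁) + Q₁₀ * W₂ = Matrix.fromCols Db₂ (0 : Matrix μ ρ₁ ℝ))
    (hup : (τ₂ * Dbar).det ≠ 0) (hlow : (τ₁ * W₀.toCols₂).det ≠ 0)
    (t1' : τ₂ * Db₁ = 0) (t2' : τ₂ * Db₂ = 0) (uLow : secondVar (τ₁ * W₀.toCols₂) (τ₁ * W₁.toCols₂) (τ₁ * W₂.toCols₂) = 0) :
    secondVar (Matrix.fromRows (τ₂ * Q₁₀) τ₁ * W₀) (Matrix.fromRows (τ₂ * Q₁₁) (0 : Matrix ρ₁ ν ℝ) * W₀ + Matrix.fromRows (τ₂ * Q₁₀) τ₁ * W₁)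
        (Matrix.fromRows (τ₂ * Q₁₂) (0 : Matrix ρ₁ ν ℝ) * W₀ + Matrix.fromRows (τ₂ * Q₁₁) (0 : Matrix ρ₁ ν ℝ) * W₁
          + (Matrix.fromRows (τ₂ * Q₁₁) (0 : Matrix ρ₁ ν ℝ) * W₁ + Matrix.fromRows (τ₂ * Q₁₀) τ₁ * W₂)) = 0 :=
  secondVar_nestedFP_eq_zero_of_blocks τ₁ τ₂ Q₁₀ Q₁₁ Q₁₂ W₀ W₁ W₂ Dbar Db₁ Db₂ c0 c1 c2 hup hlow
    (by rw [t1', t2']; exact secondVar_zero_jets _) uLow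

omit [Fintype ρ₁] [Fintype ρ₂] [DecidableEq ρ₁] [DecidableEq ρ₂] in
/-- [folklore] the dead form of a coarse letter: `J = [D̄ₖ | 0]` and `τ₂ · J = 0` give `τ₂ · D̄ₖ = 0` (left column block, definitional). -/
theorem mul_eq_zero_of_letter_of_mul_eq_zero (τ₂ : Matrix ρ₂ μ ℝ) (J : Matrix μ (ρ₂ ⊕ ρ₁) ℝ) (Db : Matrix μ ρ₂ ℝ)
    (c : J = Matrix.fromCols Db (0 : Matrix μ ρ₁ ℝ)) (t : τ₂ * J = 0) : τ₂ * Db = 0 := by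
  subst c
  exact Matrix.ext fun i j => congrFun (congrFun t i) (Sum.inl j)

/-- [folklore] **THE DOOR's `uT` SOCKET WITH ITS `t1 t2` KEPT AND `s1 s2` REPLACED BY THE FINE BLOCK's `secondVar = 0`**: the coarse dead rows in the
door's product form `t1 : τ₂ (Q₁₁ W₀ + Q₁₀ W₁) = 0`, `t2 : τ₂ (Q₁₂ W₀ + 2•Q₁₁ W₁ + Q₁₀ W₂) = 0` (unchanged), and instead of `s1 : τ₁ W₁ = 0`, `s2 : τ₁ W₂ = 0` the
single letter `uLow : secondVar (τ₁ W₀ˡᵒʷ) (τ₁ W₁ˡᵒʷ) (τ₁ W₂ˡᵒʷ) = 0` (AUTOMATIC at the (B) torus call: `torus_uLow_exp` below). -/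
theorem secondVar_nestedFP_eq_zero_of_t_uLow (τ₁ : Matrix ρ₁ ν ℝ) (τ₂ : Matrix ρ₂ μ ℝ) (Q₁₀ Q₁₁ Q₁₂ : Matrix μ ν ℝ) (W₀ W₁ W₂ : Matrix ν (ρ₂ ⊕ ρ₁) ℝ)
    (Dbar Db₁ Db₂ : Matrix μ ρ₂ ℝ)
    (c0 : Q₁₀ * W₀ = Matrix.fromCols Dbar (0 : Matrix μ ρ₁ ℝ)) (c1 : Q₁₁ * W₀ + Q₁₀ * W₁ = Matrix.fromCols Db₁ (0 : Matrix μ ρ₁ ℝ))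
    (c2 : Q₁₂ * W₀ + (2 : ℝ) • (Q₁₁ * W₁) + Q₁₀ * W₂ = Matrix.fromCols Db₂ (0 : Matrix μ ρ₁ ℝ))
    (hup : (τ₂ * Dbar).det ≠ 0) (hlow : (τ₁ * W₀.toCols₂).det ≠ 0)
    (t1 : τ₂ * (Q₁₁ * W₀ + Q₁₀ * W₁) = 0) (t2 : τ₂ * (Q₁₂ * W₀ + (2 : ℝ) • (Q₁₁ * W₁) + Q₁₀ * W₂) = 0)
    (uLow : secondVar (τ₁ * W₀.toCols₂) (τ₁ * W₁.toCols₂) (τ₁ * W₂.toCols₂) = 0) :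
    secondVar (Matrix.fromRows (τ₂ * Q₁₀) τ₁ * W₀) (Matrix.fromRows (τ₂ * Q₁₁) (0 : Matrix ρ₁ ν ℝ) * W₀ + Matrix.fromRows (τ₂ * Q₁₀) τ₁ * W₁)
        (Matrix.fromRows (τ₂ * Q₁₂) (0 : Matrix ρ₁ ν ℝ) * W₀ + Matrix.fromRows (τ₂ * Q₁₁) (0 : Matrix ρ₁ ν ℝ) * W₁
          + (Matrix.fromRows (τ₂ * Q₁₁) (0 : Matrix ρ₁ ν ℝ) * W₁ + Matrix.fromRows (τ₂ * Q₁₀) τ₁ * W₂)) = 0 :=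
  secondVar_nestedFP_eq_zero_of_dead_top τ₁ τ₂ Q₁₀ Q₁₁ Q₁₂ W₀ W₁ W₂ Dbar Db₁ Db₂ c0 c1 c2 hup hlow
    (mul_eq_zero_of_letter_of_mul_eq_zero τ₂ _ Db₁ c1 t1) (mul_eq_zero_of_letter_of_mul_eq_zero τ₂ _ Db₂ c2 t2) uLow

end Nested

/-! ## §3 At the (B) torus call: the fine block's Faddeev–Popov 2-jet vanishes AUTOMATICALLY (no `hsmall`, any direction `h`) -/

section Torus

variable {d : ℕ} (M' : Fin (d + 1) → ℕ) {Lc : ℕ} [NeZero Lc] {r r' : Fin (d + 1) → ℕ}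

/-- [folklore] **`uLow` AT THE (B) TORUS CALL IS AUTOMATIC**: with `τ₁` the small-comb slice and `W₀ = [D₂ | D₁]` of record (`hτ₁ hD₁` VERBATIM p313662 ∕ #12),
and the nested chart's generator jets in the exponential closed forms along ANY direction `h` (`hW₁ hW₂` as in `TorusGeneratorIntertwiningTwo.torus_s1_of_dead`):
`secondVar (τ₁ · [D₂|D₁]ˡᵒʷ) (τ₁ · W₁ˡᵒʷ) (τ₁ · W₂ˡᵒʷ) = 0` — `TorusOneShotFPExponential.secondVar_combRowsT_expJets_eq_zero` on the SMALL comb (forest-triangular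
with `d₀·d₂ = d₁²` per site); NO `hsmall`, NO comb-support hypothesis on `h`. -/
theorem torus_uLow_exp (hr : r ∈ box (d + 1) Lc)
    {τ₁ : Matrix (Res (toSite r) Lc (fine Lc M')) (↥(pbox (fine Lc M')) × Fin (d + 1)) ℝ}
    (hτ₁ : τ₁ = (combRowsT (toSite r) Lc (fine Lc M')).submatrix id
        (fun b : ↥(pbox (fine Lc M')) × Fin (d + 1) => ((b.1, Sum.inl b.2) : Idx (fine Lc M') (Fib d))))
    {D₁ : Matrix (↥(pbox (fine Lc M')) × Fin (d + 1)) (Res (toSite r) Lc (fine Lc M')) ℝ}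
    (hD₁ : D₁ = (tgrad (fine Lc M')).submatrix (fun b : ↥(pbox (fine Lc M')) × Fin (d + 1) => ((b.1, Sum.inl b.2) : Idx (fine Lc M') (Fib d)))
        (Subtype.val : Res (toSite r) Lc (fine Lc M') → ↥(pbox (fine Lc M'))))
    (D₂ : Matrix (↥(pbox (fine Lc M')) × Fin (d + 1)) (Res (toSite r') Lc M') ℝ)
    (c : ℝ) (h : ↥(pbox (fine Lc M')) × Fin (d + 1) → ℝ)
    {W₁ W₂ : Matrix (↥(pbox (fine Lc M')) × Fin (d + 1)) (Res (toSite r') Lc M' ⊕ Res (toSite r) Lc (fine Lc M')) ℝ}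
    (hW₁ : W₁ = Matrix.of fun (b : ↥(pbox (fine Lc M')) × Fin (d + 1)) (e : Res (toSite r') Lc M' ⊕ Res (toSite r) Lc (fine Lc M')) =>
        -(c * h b * Sum.elim (fun t : Res (toSite r') Lc M' => tdelta M' (quo Lc ((b.1 : Site (d + 1)) + unitVec b.2)) t.1)
          (fun s : Res (toSite r) Lc (fine Lc M') => tdelta (fine Lc M') ((b.1 : Site (d + 1)) + unitVec b.2) s.1) e))
    (hW₂ : W₂ = Matrix.of fun (b : ↥(pbox (fine Lc M')) × Fin (d + 1)) (e : Res (toSite r') Lc M' ⊕ Res (toSite r) Lc (fine Lc M')) =>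
        (c * h b) ^ 2 * Sum.elim (fun t : Res (toSite r') Lc M' => tdelta M' (quo Lc ((b.1 : Site (d + 1)) + unitVec b.2)) t.1)
          (fun s : Res (toSite r) Lc (fine Lc M') => tdelta (fine Lc M') ((b.1 : Site (d + 1)) + unitVec b.2) s.1) e) :
    secondVar (τ₁ * (Matrix.fromCols D₂ D₁).toCols₂) (τ₁ * W₁.toCols₂) (τ₁ * W₂.toCols₂) = 0 := by
  subst hτ₁ hD₁ hW₁ hW₂
  have hLc : 0 < Lc := Nat.pos_of_ne_zero (NeZero.ne Lc)
  -- the two jet products as `combRowsT · (jet on the full torus index) ↾ Subtype.val`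
  have e1 : (combRowsT (toSite r) Lc (fine Lc M')).submatrix id
        (fun b : ↥(pbox (fine Lc M')) × Fin (d + 1) => ((b.1, Sum.inl b.2) : Idx (fine Lc M') (Fib d)))
        * (Matrix.of fun (b : ↥(pbox (fine Lc M')) × Fin (d + 1)) (e : Res (toSite r') Lc M' ⊕ Res (toSite r) Lc (fine Lc M')) =>
            -(c * h b * Sum.elim (fun t : Res (toSite r') Lc M' => tdelta M' (quo Lc ((b.1 : Site (d + 1)) + unitVec b.2)) t.1)
              (fun s : Res (toSite r) Lc (fine Lc M') => tdelta (fine Lc M') ((b.1 : Site (d + 1)) + unitVec b.2) s.1) e)).toCols₂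
      = combRowsT (toSite r) Lc (fine Lc M')
          * (Matrix.of fun (q : Idx (fine Lc M') (Fib d)) (s : ↥(pbox (fine Lc M'))) =>
              Sum.elim (fun a : Fin (d + 1) => -(c * h (q.1, a)) * tdelta (fine Lc M') ((q.1 : Site (d + 1)) + unitVec a) s) (fun _ => (0 : ℝ)) q.2).submatrix
            id Subtype.val := by
    rw [← submatrix_id_mul, ← submatrix_field_mul (fine Lc M') _ _ (fun y κ c => rfl)]
    congr 1
    ext b s
    simp only [Matrix.toCols₂_apply, Matrix.of_apply, Matrix.submatrix_apply, Sum.elim_inr, Sum.elim_inl]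
    ring
  have e2 : (combRowsT (toSite r) Lc (fine Lc M')).submatrix id
        (fun b : ↥(pbox (fine Lc M')) × Fin (d + 1) => ((b.1, Sum.inl b.2) : Idx (fine Lc M') (Fib d)))
        * (Matrix.of fun (b : ↥(pbox (fine Lc M')) × Fin (d + 1)) (e : Res (toSite r') Lc M' ⊕ Res (toSite r) Lc (fine Lc M')) =>
            (c * h b) ^ 2 * Sum.elim (fun t : Res (toSite r') Lc M' => tdelta M' (quo Lc ((b.1 : Site (d + 1)) + unitVec b.2)) t.1)
              (fun s : Res (toSite r) Lc (fine Lc M') => tdelta (fine Lc M') ((b.1 : Site (d + 1)) + unitVec b.2) s.1) e).toCols₂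
      = combRowsT (toSite r) Lc (fine Lc M')
          * (Matrix.of fun (q : Idx (fine Lc M') (Fib d)) (s : ↥(pbox (fine Lc M'))) =>
              Sum.elim (fun a : Fin (d + 1) => (c * h (q.1, a)) ^ 2 * tdelta (fine Lc M') ((q.1 : Site (d + 1)) + unitVec a) s) (fun _ => (0 : ℝ)) q.2).submatrix
            id Subtype.val := by
    rw [← submatrix_id_mul, ← submatrix_field_mul (fine Lc M') _ _ (fun y κ c => rfl)]
    congr 1
  -- the zeroth product: `τ₁ · [D₂|D₁]ˡᵒʷ = combRowsT · tgrad↾Subtype.val` (`erw`: the record's `Subtype.val` column map carries the raw subtype as its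
  -- index type, the product's declared column type is `Res`)
  rw [Matrix.toCols₂_fromCols, e1, e2]
  erw [submatrix_field_mul (fine Lc M') _ _ (TorusGaugeCovariance.tgrad_inr (fine Lc M')), submatrix_id_mul]
  exact secondVar_combRowsT_expJets_eq_zero hLc (toSite_mem_range hr) (dvd_fine M') c h

end Torus

end Summit.QuantumFields.BalabanUV.Beta.FP.NestedFPSplit

end
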